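import Summits.BirchSwinnertonDyer.BirchSwinnertonDyer.Theorems.QuadraticBranchSignedControlPlusEtaNonsurjPlusCoeffCongruenceLambda
import Summits.BirchSwinnertonDyer.BirchSwinnertonDyer.Theorems.QuadraticBranchSignedControlPlusEtaNonsurjMinusCoeffCongruenceLambda
import HarnessLib

/-!
# Route `QuadraticBranchSignedControl` (rung K8, cell `bsd-potss`), residual crux `PlusEtaMainConjectureNonsurj`
# (stmt-BirchSwinnertonDyer-19606): THE WIDE λ⁻-READING — `μ(L_p⁻(V,η,X)) = 0 ∧ λ(L_p⁻) = λ` for every `λ < p(p−1)` read off ONE odd-level Mazur–Tate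
# element `θ_{2m+1}(η)` with `m ≥ 1` (seat `bsd-potss-k8eta-c2` g25; widens g24's `…MinusCoeffCongruenceLambda.lean` from `λ < p` to `λ < p(p−1)`)

WHY. g24's λ⁻-reading (`lambda_reading_of_padicNorm`) needs `λ < p` for ONE reason: its remainder bound `p^{2m+1} ∣ (ω_{2m+1})_s = C(p^{2m+1}, s)` is proved
for `0 < s < p` only. For `0 < s < p²` one still has `p^{2m} ∣ C(p^{2m+1}, s)` (`v_p(s) ≤ 1`), whose norm `p^{−2m}` is `≤ p^{−(m+1)}` as soon as `m ≥ 1`, while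
the off-diagonal structure constants keep `p^m ∣ (ω⁺_{2m+1})_s` for ALL `0 < s < p(p−1)` (the first factor `Φ_{p²}(1+X)` of `ω⁺_{2m+1}` has degree `p(p−1)`,
g24's `pow_dvd_coeff_cyclotomicOmegaPlus_two_mul_add_one`). Hence at every odd level `2m+1 ≥ 3` the reading extends to `λ < p(p−1)` (at `p = 5`: `λ⁻ ≤ 19`
from level `3`, versus `λ⁻ ≤ 4`): the 215 CM rows of the `p = 5` census with PARI `λ⁻ ∈ [5,14]` become exactly readable (k8eta-c2 g25 P-25W, pre-registered).
Contrast with the plus side, where the first factor `Φ_p(1+X)` of `ω⁻_{2m}` has degree `p − 1` and an elimination step is needed at `k = p − 1` (`…PlusCoeffCongruenceTop`).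

WHAT. §11 `prime_pow_pred_dvd_choose_prime_pow` (`p^{N−1} ∣ C(p^N, s)` for `0 < s < p²`), `exists_coeff_mazurTate_eq_sum_wide` (the triangular identity
for `k < p²` with remainder `p^{2m}`), `norm_sub_le_of_forall_norm_le_wide` (step, `m ≥ 1`, `k < p(p−1)`), `forall_norm_le_of_forall_norm_theta_le_wide`
(induction), `lambda_reading_wide_of_padicNorm` (the reading for every minus branch function, `λ < p(p−1)`), `hasUnitContent_and_mu_lam_minus_wide_of_padicNorm`
(bridge to `HasUnitContent ∧ X1.MuLambda.mu = 0 ∧ X1.MuLambda.lam = λ ∧ normLam = λ`).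

HONEST FRAMING (cell `bsd-potss`; FULL-BSD rank ≤ 1 programme, HUMAN RULING D-0036/D-0074): TOOL THEOREMS ONLY — no definition, no named fact,
no `sorry`, axioms standard; nothing about (A), (C1⁺_η), C-cc-1 or `BSD(W,p)` of any pair is claimed; no stub of 19606 is proved; crux and route
OPEN; nothing booked. `--supports stmt-BirchSwinnertonDyer-19606`.

References: [Pollack2003] Prop. 6.18, §6.5; [Kobayashi2003] Thm. 3.2, (3.5), (3.7) (p. 7); [Washington1997] §7.1.
-/

set_option autoImplicit false
set_option linter.dupNamespace false
noncomputable section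

open scoped Classical MatrixGroups ModularForm

open CongruenceSubgroup Polynomial Literature.NumberTheory.EllipticCurves
  Literature.NumberTheory.EllipticCurves.ModularForms
  Literature.NumberTheory.EllipticCurves.GreenbergVatsal2000
open Summit.BirchSwinnertonDyer.Rank1Residual Summit.BirchSwinnertonDyer.Rank1Residual.Additive

namespace Summit.BirchSwinnertonDyer.BirchSwinnertonDyer.Theorems.EtaMinusCoeffCongruence

variable {p : ℕ} [hp : Fact p.Prime]

/-! ## §11 The wide reading `λ < p(p−1)` at odd levels `≥ 3` -/

/-- `p^{N−1} ∣ C(p^N, s)` for `0 < s < p²` (`s·C(p^N,s) = p^N·C(p^N−1,s−1)` and `v_p(s) ≤ 1`). [folklore] -/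
theorem prime_pow_pred_dvd_choose_prime_pow {s : ℕ} (N : ℕ) (hs0 : 0 < s) (hsp : s < p ^ 2) : p ^ (N - 1) ∣ (p ^ N).choose s := by
  have hP := hp.out
  by_cases hps : p ∣ s
  · obtain ⟨t, rfl⟩ := hps
    have ht0 : 0 < t := Nat.pos_of_mul_pos_left hs0
    have htp : t < p := by
      by_contra h
      have : p ^ 2 ≤ p * t := by rw [pow_two]; exact Nat.mul_le_mul_left p (not_lt.mp h)
      omega
    rcases Nat.eq_zero_or_pos N with rfl | hN
    · simp
    · -- `(p t)·C(p^N, p t) = p^N · C(p^N − 1, p t − 1)`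
      obtain ⟨s', hs'⟩ : ∃ s', p * t = s' + 1 := ⟨p * t - 1, by omega⟩
      have h := Nat.add_one_mul_choose_eq (p ^ N - 1) s'
      have hpn : p ^ N - 1 + 1 = p ^ N := Nat.sub_add_cancel (Nat.one_le_pow _ _ hP.pos)
      rw [hpn, ← hs'] at h
      -- `t · C(p^N, pt) = p^{N-1} · C(p^N − 1, pt − 1)`
      have h' : t * (p ^ N).choose (p * t) = p ^ (N - 1) * (p ^ N - 1).choose s' := by
        have hpN : p ^ N = p * p ^ (N - 1) := by rw [← pow_succ']; congr 1; omega
        have := h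
        rw [hpN] at this ⊢
        have h3 : p * (t * (p * p ^ (N - 1)).choose (p * t)) = p * (p ^ (N - 1) * (p * p ^ (N - 1) - 1).choose s') := by
          calc p * (t * (p * p ^ (N - 1)).choose (p * t)) = (p * p ^ (N - 1)).choose (p * t) * (p * t) := by ring
            _ = p * p ^ (N - 1) * (p * p ^ (N - 1) - 1).choose s' := this.symm
            _ = p * (p ^ (N - 1) * (p * p ^ (N - 1) - 1).choose s') := by ring
        exact Nat.eq_of_mul_eq_mul_left hP.pos h3
      have hcop : Nat.Coprime (p ^ (N - 1)) t :=
        Nat.Coprime.pow_left _ ((Nat.Prime.coprime_iff_not_dvd hP).mpr fun hd ↦ absurd (Nat.le_of_dvd ht0 hd) (by omega))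
      exact hcop.dvd_of_dvd_mul_left ⟨(p ^ N - 1).choose s', h'.symm ▸ by ring⟩
  · have hsp' : ¬ p ∣ s := hps
    obtain ⟨s', rfl⟩ : ∃ s', s = s' + 1 := ⟨s - 1, by omega⟩
    have h := Nat.add_one_mul_choose_eq (p ^ N - 1) s'
    have hpn : p ^ N - 1 + 1 = p ^ N := Nat.sub_add_cancel (Nat.one_le_pow _ _ hP.pos)
    rw [hpn] at h
    have hcop : Nat.Coprime (p ^ N) (s' + 1) := Nat.Coprime.pow_left N ((Nat.Prime.coprime_iff_not_dvd hP).mpr hsp')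
    exact (Nat.pow_dvd_pow p (Nat.sub_le N 1)).trans (hcop.dvd_of_dvd_mul_right ⟨(p ^ N - 1).choose s', h.symm⟩)

section MazurTate

variable {N : ℕ} [NeZero N] {f : CuspForm (Gamma0 N) 2}

/-- **The triangular identity for `coeff_k M`, `k < p²`, with remainder `p^{2m}`**: if `M ∈ Λ` satisfies
`θ_{2m+1}(η) ≡ (−1)^{m+1}ω⁺_{2m+1}M (mod ω_{2m+1})` then for every `k < p²` there is `r ∈ ℤ_p` with
`coeff_kθ_{2m+1}(η) = (−1)^{m+1}Σ_{s+t=k}(ω⁺_{2m+1})_s·coeff_tM + p^{2m}·r` (`p^{2m} ∣ C(p^{2m+1}, s)` for `0 < s < p²`). [cite: Pollack2003, Prop. 6.18] -/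
theorem exists_coeff_mazurTate_eq_sum_wide (hp2 : p ≠ 2) (hf0 : IsNewform0 f) (hQ : coeffField f = ⊥)
    (hpN : ¬ p ∣ N) (hap : cuspCoeff f p = ((0 : ℤ) : ℂ)) (m : ℕ) {k : ℕ} (hk : k < p ^ 2) {M : IwasawaAlgebra p}
    (hM : IsCongrModOmega p (2 * m + 1) (quadraticBranchMazurTateElement p f (2 * m + 1))
      ((-1) ^ (m + 1) * cyclotomicOmegaPlus p (2 * m + 1)) M) :
    ∃ r : ℤ_[p], (((quadraticBranchMazurTateElement p f (2 * m + 1)).coeff k : ℚ) : ℚ_[p]) =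
      (-1) ^ (m + 1) * (∑ x ∈ Finset.HasAntidiagonal.antidiagonal k,
        (((cyclotomicOmegaPlus p (2 * m + 1)).coeff x.1 : ℤ) : ℚ_[p]) * ((PowerSeries.coeff x.2 M : ℤ_[p]) : ℚ_[p])) +
        (p : ℚ_[p]) ^ (2 * m) * (r : ℚ_[p]) := by
  obtain ⟨Θ, q, hΘ, hid⟩ := exists_sub_eq_omega_mul_of_isCongrModOmega hp2 hf0 hQ hpN hap hM
  set ωp : ℤ_[p][X] := ((-1) ^ (m + 1) * cyclotomicOmegaPlus p (2 * m + 1)).map (Int.castRingHom ℤ_[p]) with hωp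
  set Ω : ℤ_[p][X] := (cyclotomicOmega p (2 * m + 1)).map (Int.castRingHom ℤ_[p]) with hΩ
  have hΩdvd : ∀ s ≤ k, (p : ℤ_[p]) ^ (2 * m) ∣ Ω.coeff s := by
    intro s hs
    rcases Nat.eq_zero_or_pos s with rfl | hs0
    · rw [hΩ, Polynomial.coeff_map, coeff_zero_cyclotomicOmega, map_zero]
      exact dvd_zero _
    · rw [hΩ, Polynomial.coeff_map, coeff_cyclotomicOmega_of_pos _ hs0, map_natCast]
      have h := Nat.cast_dvd_cast (α := ℤ_[p]) (prime_pow_pred_dvd_choose_prime_pow (p := p) (2 * m + 1) hs0 (by omega))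
      rw [show 2 * m + 1 - 1 = 2 * m by omega] at h
      push_cast at h
      exact h
  have hdvd : (p : ℤ_[p]) ^ (2 * m) ∣ PowerSeries.coeff k ((Ω : PowerSeries ℤ_[p]) * q) := by
    rw [PowerSeries.coeff_mul]
    refine Finset.dvd_sum fun x hx ↦ ?_
    have hx' : x.1 + x.2 = k := Finset.HasAntidiagonal.mem_antidiagonal.mp hx
    rw [Polynomial.coeff_coe]
    exact Dvd.dvd.mul_right (hΩdvd x.1 (by omega)) _
  obtain ⟨r, hr⟩ := hdvd
  refine ⟨r, ?_⟩
  have hωcoeff : ∀ s, ωp.coeff s = (-1) ^ (m + 1) * (((cyclotomicOmegaPlus p (2 * m + 1)).coeff s : ℤ) : ℤ_[p]) := by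
    intro s
    rw [hωp, Polynomial.coeff_map, show ((-1 : ℤ[X]) ^ (m + 1)) = C ((-1 : ℤ) ^ (m + 1)) by simp, coeff_C_mul]
    simp
  have h1 := congrArg (PowerSeries.coeff k) hid
  rw [map_sub, hr, PowerSeries.coeff_mul, Polynomial.coeff_coe] at h1
  simp only [Polynomial.coeff_coe, hωcoeff] at h1
  have hΘk : Θ.coeff k = (-1) ^ (m + 1) * (∑ x ∈ Finset.HasAntidiagonal.antidiagonal k,
      (((cyclotomicOmegaPlus p (2 * m + 1)).coeff x.1 : ℤ) : ℤ_[p]) * PowerSeries.coeff x.2 M) +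
      (p : ℤ_[p]) ^ (2 * m) * r := by
    rw [Finset.mul_sum]
    have : ∑ x ∈ Finset.HasAntidiagonal.antidiagonal k, (-1) ^ (m + 1) *
        ((((cyclotomicOmegaPlus p (2 * m + 1)).coeff x.1 : ℤ) : ℤ_[p]) * PowerSeries.coeff x.2 M) =
        ∑ x ∈ Finset.HasAntidiagonal.antidiagonal k, (-1) ^ (m + 1) * (((cyclotomicOmegaPlus p (2 * m + 1)).coeff x.1 : ℤ) : ℤ_[p]) *
          PowerSeries.coeff x.2 M := Finset.sum_congr rfl fun x _ ↦ by ring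
    rw [this]
    linear_combination h1
  have hc := congrArg (fun P : ℚ_[p][X] ↦ P.coeff k) hΘ
  simp only [Polynomial.coeff_map, eq_ratCast] at hc
  rw [← hc, hΘk]
  simp only [map_add, map_mul, map_sum, map_pow, map_neg, map_one, map_natCast, map_intCast,
    PadicInt.algebraMap_apply]

omit [NeZero N] in
/-- **One step of the wide induction** (`m ≥ 1`, `k < p(p−1)`, remainder `p^{2m}`): `‖ϖ·coeff_tM‖ ≤ p^{−1}` for `t < k` gives
`‖ϖ·coeff_kθ − (−1)^{m+1}p^m·ϖ·coeff_kM‖ ≤ p^{−(m+1)}`. [cite: Pollack2003, Prop. 6.18] -/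
theorem norm_sub_le_of_forall_norm_le_wide (m : ℕ) (hm : 1 ≤ m) {k : ℕ} (hk : k < p * (p - 1)) {M : IwasawaAlgebra p} {θk : ℚ_[p]}
    {r : ℤ_[p]}
    (hid : θk = (-1) ^ (m + 1) * (∑ x ∈ Finset.HasAntidiagonal.antidiagonal k,
        (((cyclotomicOmegaPlus p (2 * m + 1)).coeff x.1 : ℤ) : ℚ_[p]) * ((PowerSeries.coeff x.2 M : ℤ_[p]) : ℚ_[p])) +
        (p : ℚ_[p]) ^ (2 * m) * (r : ℚ_[p]))
    {ϖ : ℚ_[p]} (hϖ : ‖ϖ‖ ≤ 1)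
    (hIH : ∀ t < k, ‖ϖ * ((PowerSeries.coeff t M : ℤ_[p]) : ℚ_[p])‖ ≤ (p : ℝ)⁻¹) :
    ‖ϖ * θk - (-1) ^ (m + 1) * (p : ℚ_[p]) ^ m * (ϖ * ((PowerSeries.coeff k M : ℤ_[p]) : ℚ_[p]))‖ ≤
      ((p : ℝ)⁻¹) ^ (m + 1) := by
  have hP : p.Prime := hp.out
  have hp1 : (1 : ℝ) < p := by exact_mod_cast hP.one_lt
  have hp0 : (0 : ℝ) < p := by positivity
  have hpi0 : (0 : ℝ) ≤ (p : ℝ)⁻¹ := inv_nonneg.mpr hp0.le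
  have hpi1 : (p : ℝ)⁻¹ ≤ 1 := inv_le_one_of_one_le₀ hp1.le
  set S := Finset.HasAntidiagonal.antidiagonal k with hS
  set g : ℕ × ℕ → ℚ_[p] := fun x ↦
    (((cyclotomicOmegaPlus p (2 * m + 1)).coeff x.1 : ℤ) : ℚ_[p]) * ((PowerSeries.coeff x.2 M : ℤ_[p]) : ℚ_[p]) with hg
  have hmem : ((0, k) : ℕ × ℕ) ∈ S := by rw [hS, Finset.HasAntidiagonal.mem_antidiagonal]; simp
  have hsplit := Finset.add_sum_erase S g hmem
  have hg0 : g (0, k) = (p : ℚ_[p]) ^ m * ((PowerSeries.coeff k M : ℤ_[p]) : ℚ_[p]) := by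
    rw [hg]
    dsimp only
    rw [coeff_zero_cyclotomicOmegaPlus_two_mul_add_one]
    push_cast
    ring
  have hms : ϖ * ∑ x ∈ S.erase (0, k), g x = ∑ x ∈ S.erase (0, k), ϖ * g x := by rw [Finset.mul_sum]
  have hdiff : ϖ * θk - (-1) ^ (m + 1) * (p : ℚ_[p]) ^ m * (ϖ * ((PowerSeries.coeff k M : ℤ_[p]) : ℚ_[p])) =
      (-1) ^ (m + 1) * ∑ x ∈ S.erase (0, k), ϖ * g x + (p : ℚ_[p]) ^ (2 * m) * (ϖ * (r : ℚ_[p])) := by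
    rw [← hms, hid, ← hsplit, hg0]
    ring
  rw [hdiff]
  have hterm : ∀ x ∈ S.erase (0, k), ‖ϖ * g x‖ ≤ ((p : ℝ)⁻¹) ^ (m + 1) := by
    intro x hx
    obtain ⟨hne, hxS⟩ := Finset.mem_erase.mp hx
    have hsum : x.1 + x.2 = k := by rw [hS] at hxS; exact Finset.HasAntidiagonal.mem_antidiagonal.mp hxS
    have hx1 : 1 ≤ x.1 := by
      rcases Nat.eq_zero_or_pos x.1 with h0 | h0
      · exact absurd (Prod.ext h0 (by show x.2 = k; omega)) hne
      · exact h0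
    have hx1lt : x.1 < p * (p - 1) := by omega
    have hdvd := pow_dvd_coeff_cyclotomicOmegaPlus_two_mul_add_one (p := p) m x.1 hx1lt
    have hω : ‖(((cyclotomicOmegaPlus p (2 * m + 1)).coeff x.1 : ℤ) : ℚ_[p])‖ ≤ (p : ℝ) ^ (-(m : ℤ)) :=
      (Padic.norm_int_le_pow_iff_dvd _ _).mpr (by exact_mod_cast hdvd)
    have hMt := hIH x.2 (by omega)
    rw [hg]
    dsimp only
    calc ‖ϖ * ((((cyclotomicOmegaPlus p (2 * m + 1)).coeff x.1 : ℤ) : ℚ_[p]) *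
          ((PowerSeries.coeff x.2 M : ℤ_[p]) : ℚ_[p]))‖
        = ‖(((cyclotomicOmegaPlus p (2 * m + 1)).coeff x.1 : ℤ) : ℚ_[p])‖ *
            ‖ϖ * ((PowerSeries.coeff x.2 M : ℤ_[p]) : ℚ_[p])‖ := by
          rw [← norm_mul]; ring_nf
      _ ≤ (p : ℝ) ^ (-(m : ℤ)) * (p : ℝ)⁻¹ := mul_le_mul hω hMt (norm_nonneg _) (by positivity)
      _ = ((p : ℝ)⁻¹) ^ (m + 1) := by rw [zpow_neg, zpow_natCast, ← inv_pow, pow_succ]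
  have hsum_le : ‖∑ x ∈ S.erase (0, k), ϖ * g x‖ ≤ ((p : ℝ)⁻¹) ^ (m + 1) :=
    IsUltrametricDist.norm_sum_le_of_forall_le_of_nonneg (by positivity) hterm
  have hA : ‖(-1 : ℚ_[p]) ^ (m + 1) * ∑ x ∈ S.erase (0, k), ϖ * g x‖ ≤ ((p : ℝ)⁻¹) ^ (m + 1) := by
    rw [norm_mul, norm_pow, norm_neg, norm_one, one_pow, one_mul]; exact hsum_le
  have hB : ‖(p : ℚ_[p]) ^ (2 * m) * (ϖ * (r : ℚ_[p]))‖ ≤ ((p : ℝ)⁻¹) ^ (m + 1) := by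
    rw [norm_mul, norm_mul, norm_pow, Padic.norm_p, PadicInt.padic_norm_e_of_padicInt]
    calc ((p : ℝ)⁻¹) ^ (2 * m) * (‖ϖ‖ * ‖r‖) ≤ ((p : ℝ)⁻¹) ^ (2 * m) * (1 * 1) := by
          gcongr
          exact PadicInt.norm_le_one r
      _ ≤ ((p : ℝ)⁻¹) ^ (m + 1) := by
          rw [mul_one, mul_one]; exact pow_le_pow_of_le_one hpi0 hpi1 (by omega)
  exact (IsUltrametricDist.norm_add_le_max _ _).trans (max_le hA hB)

/-- **The wide induction** (`m ≥ 1`, `λ < p(p−1)`): `‖ϖ·coeff_jθ_{2m+1}(η)‖ ≤ p^{−(m+1)}` for `1 ≤ j < λ` gives `‖ϖ·coeff_jM‖ ≤ p^{−1}` for `j < λ`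
(`M(0) = 0`). [cite: Pollack2003, Prop. 6.18] -/
theorem forall_norm_le_of_forall_norm_theta_le_wide (hp2 : p ≠ 2) (hf0 : IsNewform0 f) (hQ : coeffField f = ⊥)
    (hpN : ¬ p ∣ N) (hap : cuspCoeff f p = ((0 : ℤ) : ℂ)) (m : ℕ) (hm : 1 ≤ m) {lam : ℕ} (hlam : lam < p * (p - 1))
    {M : IwasawaAlgebra p} (hM0 : PowerSeries.constantCoeff M = 0)
    (hM : IsCongrModOmega p (2 * m + 1) (quadraticBranchMazurTateElement p f (2 * m + 1))
      ((-1) ^ (m + 1) * cyclotomicOmegaPlus p (2 * m + 1)) M)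
    {ϖ : ℚ_[p]} (hϖ : ‖ϖ‖ ≤ 1)
    (hθ : ∀ j, 1 ≤ j → j < lam →
      ‖ϖ * (((quadraticBranchMazurTateElement p f (2 * m + 1)).coeff j : ℚ) : ℚ_[p])‖ ≤ ((p : ℝ)⁻¹) ^ (m + 1)) :
    ∀ j < lam, ‖ϖ * ((PowerSeries.coeff j M : ℤ_[p]) : ℚ_[p])‖ ≤ (p : ℝ)⁻¹ := by
  have hP : p.Prime := hp.out
  have hp1 : (1 : ℝ) < p := by exact_mod_cast hP.one_lt
  have hp0 : (0 : ℝ) < p := by positivity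
  have hpp : p * (p - 1) ≤ p ^ 2 := by rw [pow_two]; exact Nat.mul_le_mul_left p (Nat.sub_le p 1)
  intro j
  induction j using Nat.strong_induction_on with
  | _ j ih =>
    intro hj
    rcases Nat.eq_zero_or_pos j with rfl | hj0
    · rw [PowerSeries.coeff_zero_eq_constantCoeff_apply, hM0, PadicInt.coe_zero, mul_zero, norm_zero]
      positivity
    · obtain ⟨r, hr⟩ := exists_coeff_mazurTate_eq_sum_wide hp2 hf0 hQ hpN hap m (show j < p ^ 2 by omega) hM
      have hstep := norm_sub_le_of_forall_norm_le_wide m hm (show j < p * (p - 1) by omega) hr hϖ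
        (fun t ht ↦ ih t ht (by omega))
      have hθj := hθ j hj0 hj
      set a : ℚ_[p] := ϖ * (((quadraticBranchMazurTateElement p f (2 * m + 1)).coeff j : ℚ) : ℚ_[p]) with ha
      set b : ℚ_[p] := (-1 : ℚ_[p]) ^ (m + 1) * (p : ℚ_[p]) ^ m *
        (ϖ * ((PowerSeries.coeff j M : ℤ_[p]) : ℚ_[p])) with hb
      have hle : ‖b‖ ≤ ((p : ℝ)⁻¹) ^ (m + 1) := by
        have e : b = a + -(a - b) := by ring
        rw [e]
        refine (IsUltrametricDist.norm_add_le_max _ _).trans (max_le hθj ?_)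
        rw [norm_neg]
        exact hstep
      rw [hb] at hle
      rw [norm_mul, norm_mul, norm_pow, norm_neg, norm_one, one_pow, one_mul, norm_pow, Padic.norm_p, pow_succ] at hle
      have hpm : (0 : ℝ) < ((p : ℝ)⁻¹) ^ m := pow_pos (inv_pos.mpr hp0) m
      exact le_of_mul_le_mul_left hle hpm

/-- **THE WIDE λ⁻-READING.** `p` odd, `f` a rational `a_p = 0` newform of level prime to `p`, `‖ϖ‖_p ≤ 1`, `L` any minus branch function, `m ≥ 1`,
`λ < p(p−1)`. DISPLAYED (`θ = quadraticBranchMazurTateElement p f (2m+1)`): `‖ϖ·coeff_jθ‖ ≤ p^{−(m+1)}` for `1 ≤ j < λ` and `‖ϖ·coeff_λθ‖ = p^{−m}`.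
CONCLUSION: `coeff_jL ∉ ℤ_pˣ` (`j < λ`), `coeff_λL ∈ ℤ_pˣ` — `μ(L) = 0`, `λ(L) = λ`. [cite: Pollack2003, Prop. 6.18] [cite: Kobayashi2003, Thm. 3.2, (3.5), (3.7) (p. 7)]
[cite: Washington1997, §7.1] -/
theorem lambda_reading_wide_of_padicNorm (hp2 : p ≠ 2) (hf0 : IsNewform0 f) (hQ : coeffField f = ⊥)
    (hpN : ¬ p ∣ N) (hap : cuspCoeff f p = ((0 : ℤ) : ℂ)) {ϖ : ℚ} (hϖ : ‖(ϖ : ℚ_[p])‖ ≤ 1)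
    {L : IwasawaAlgebra p} (hL : IsQuadraticBranchMinusLFunction f p ϖ L) (m : ℕ) (hm : 1 ≤ m) {lam : ℕ}
    (hlam : lam < p * (p - 1))
    (hlow : ∀ j, 1 ≤ j → j < lam →
      ‖(ϖ : ℚ_[p]) * (((quadraticBranchMazurTateElement p f (2 * m + 1)).coeff j : ℚ) : ℚ_[p])‖ ≤ ((p : ℝ)⁻¹) ^ (m + 1))
    (htop : ‖(ϖ : ℚ_[p]) * (((quadraticBranchMazurTateElement p f (2 * m + 1)).coeff lam : ℚ) : ℚ_[p])‖ = ((p : ℝ)⁻¹) ^ m) :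
    (∀ j < lam, ¬ IsUnit (PowerSeries.coeff j L)) ∧ IsUnit (PowerSeries.coeff lam L) := by
  have hP : p.Prime := hp.out
  have hp1 : (1 : ℝ) < p := by exact_mod_cast hP.one_lt
  have hp0 : (0 : ℝ) < p := by positivity
  have hpp : p * (p - 1) ≤ p ^ 2 := by rw [pow_two]; exact Nat.mul_le_mul_left p (Nat.sub_le p 1)
  obtain ⟨M, hM⟩ := exists_isCongrModOmega_quadraticBranch_odd hp2 hf0 hQ hpN hap
  have hM0 : PowerSeries.constantCoeff M = 0 :=
    (isQuadraticBranchMinusLFunction_one_of_isCongrModOmega hp2 hf0 hQ hpN hap hM).1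
  obtain ⟨v, hv⟩ := exists_units_forall_coeff_eq hp2 hf0 hQ hpN hap hϖ hL hM
  have hsmall := forall_norm_le_of_forall_norm_theta_le_wide hp2 hf0 hQ hpN hap m hm hlam hM0 (hM m) hϖ hlow
  have hnormL : ∀ j, ‖PowerSeries.coeff j L‖ = ‖(ϖ : ℚ_[p]) * ((PowerSeries.coeff j M : ℤ_[p]) : ℚ_[p])‖ := by
    intro j
    rw [PadicInt.norm_def, hv j, norm_mul, PadicInt.padic_norm_e_of_padicInt, PadicInt.norm_units, one_mul]
  refine ⟨fun j hj hu ↦ ?_, ?_⟩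
  · have h1 : ‖PowerSeries.coeff j L‖ = 1 := PadicInt.isUnit_iff.mp hu
    rw [hnormL] at h1
    have h2 := hsmall j hj
    rw [h1] at h2
    exact absurd h2 (not_le.mpr (inv_lt_one_of_one_lt₀ hp1))
  · obtain ⟨r, hr⟩ := exists_coeff_mazurTate_eq_sum_wide hp2 hf0 hQ hpN hap m (show lam < p ^ 2 by omega) (hM m)
    have hstep := norm_sub_le_of_forall_norm_le_wide m hm hlam hr hϖ hsmall
    set a : ℚ_[p] := (ϖ : ℚ_[p]) * (((quadraticBranchMazurTateElement p f (2 * m + 1)).coeff lam : ℚ) : ℚ_[p]) with ha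
    set b : ℚ_[p] := (-1 : ℚ_[p]) ^ (m + 1) * (p : ℚ_[p]) ^ m *
      ((ϖ : ℚ_[p]) * ((PowerSeries.coeff lam M : ℤ_[p]) : ℚ_[p])) with hb
    have hlt : ‖a - b‖ < ‖a‖ := by
      rw [htop]
      refine hstep.trans_lt ?_
      rw [pow_succ]
      exact mul_lt_of_lt_one_right (pow_pos (inv_pos.mpr hp0) m) (inv_lt_one_of_one_lt₀ hp1)
    have hnb : ‖b‖ = ‖a‖ := by
      have h := Padic.add_eq_max_of_ne (p := p) (q := a - b) (r := b) (by
        intro heq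
        rw [heq] at hlt
        have := IsUltrametricDist.norm_add_le_max (a - b) b
        rw [sub_add_cancel, heq, max_self] at this
        exact absurd (lt_of_le_of_lt this hlt) (lt_irrefl _))
      rw [sub_add_cancel] at h
      rcases le_total ‖a - b‖ ‖b‖ with hle | hle
      · rw [max_eq_right hle] at h; exact h.symm
      · rw [max_eq_left hle] at h; exact absurd h (ne_of_gt hlt)
    rw [htop, hb, norm_mul, norm_mul, norm_pow, norm_neg, norm_one, one_pow, one_mul, norm_pow, Padic.norm_p] at hnb
    have hone : ‖(ϖ : ℚ_[p]) * ((PowerSeries.coeff lam M : ℤ_[p]) : ℚ_[p])‖ = 1 := by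
      have hpm : ((p : ℝ)⁻¹) ^ m ≠ 0 := pow_ne_zero _ (inv_ne_zero hp0.ne')
      field_simp at hnb
      linarith [hnb]
    exact PadicInt.isUnit_iff.mpr (by rw [hnormL, hone])

/-- **The wide certificate in the tree's vocabulary**: same data ⟹ `HasUnitContent L`, `X1.MuLambda.mu L = 0`, `X1.MuLambda.lam L = λ`, `normLam L = λ`.
[cite: Pollack2003, Prop. 6.18] [cite: GreenbergVatsal2000, p. 2, (1)–(2)] [cite: Washington1997, §7.1] -/
theorem hasUnitContent_and_mu_lam_minus_wide_of_padicNorm (hp2 : p ≠ 2) (hf0 : IsNewform0 f) (hQ : coeffField f = ⊥)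
    (hpN : ¬ p ∣ N) (hap : cuspCoeff f p = ((0 : ℤ) : ℂ)) {ϖ : ℚ} (hϖ : ‖(ϖ : ℚ_[p])‖ ≤ 1)
    {L : IwasawaAlgebra p} (hL : IsQuadraticBranchMinusLFunction f p ϖ L) (m : ℕ) (hm : 1 ≤ m) {lam : ℕ}
    (hlam : lam < p * (p - 1))
    (hlow : ∀ j, 1 ≤ j → j < lam →
      ‖(ϖ : ℚ_[p]) * (((quadraticBranchMazurTateElement p f (2 * m + 1)).coeff j : ℚ) : ℚ_[p])‖ ≤ ((p : ℝ)⁻¹) ^ (m + 1))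
    (htop : ‖(ϖ : ℚ_[p]) * (((quadraticBranchMazurTateElement p f (2 * m + 1)).coeff lam : ℚ) : ℚ_[p])‖ = ((p : ℝ)⁻¹) ^ m) :
    HasUnitContent L ∧ X1.MuLambda.mu L = 0 ∧ X1.MuLambda.lam L = lam ∧ normLam L = lam :=
  EtaPlusCoeffCongruence.hasUnitContent_and_mu_lam_of_firstUnitCoeff
    (lambda_reading_wide_of_padicNorm hp2 hf0 hQ hpN hap hϖ hL m hm hlam hlow htop)

end MazurTate

end Summit.BirchSwinnertonDyer.BirchSwinnertonDyer.Theorems.EtaMinusCoeffCongruence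

end
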